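import Summits.QuantumAdvantage.QuantumAdvantage.Theorems.ScaleDialAA

/-! # ScaleDialA — part 2/2 (mechanical split for landing of `ScaleDialA`; content verbatim; scopes re-opened with their variables) -/

set_option linter.dupNamespace false
set_option linter.style.longLine false
noncomputable section
open scoped Classical

namespace Summit.QuantumAdvantage.QuantumAdvantage.Theorems.ScaleDial
open Finset
open Literature.Computability.QuantumComplexity Literature.Computability.QuantumComplexity.RingHLF
open Literature.Computability.MetaComplexity Literature.Computability.MetaComplexity.Smolensky
open Summit.QuantumAdvantage.AdviceFreeQNC0
open Summit.QuantumAdvantage.QuantumAdvantage.Theorems.RingPeriodFold (cov covStrat covStrat_mem_lowDeg)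
open Summit.QuantumAdvantage.QuantumAdvantage.Theses.ExactnessDial (NoPerfectOdd3 PolyLossOddU3 MassStep3u OddToAll3
  DPLift3 MultiRingBridge3 NoPerfectConst3)

/-- `(log₂ n)^A + (log₂ n)^B ≤ n - 1` once `n ≥ 2^(2^(A+B+2))`. -/
theorem logpow_add_logpow_le {A B n : ℕ} (hn : 2 ^ (2 ^ (A + B + 2)) ≤ n) :
    (Nat.log 2 n) ^ A + (Nat.log 2 n) ^ B ≤ n - 1 := by
  set L := Nat.log 2 n with hL
  have hn0 : n ≠ 0 := by have := Nat.one_le_two_pow (n := 2 ^ (A + B + 2)); omega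
  have hLbig : 2 ^ (A + B + 2) ≤ L := Nat.le_log_of_pow_le (by norm_num) hn
  have hLn : 2 ^ L ≤ n := Nat.pow_log_le_self 2 hn0
  have hL2 : 2 ≤ L := le_trans (by
    calc 2 = 2 ^ 1 := rfl
      _ ≤ 2 ^ (A + B + 2) := Nat.pow_le_pow_right (by norm_num) (by omega)) hLbig
  have hA' : L ^ A ≤ L ^ (A + B) := Nat.pow_le_pow_right (by positivity) (by omega)
  have hB' : L ^ B ≤ L ^ (A + B) := Nat.pow_le_pow_right (by positivity) (by omega)
  have h3 : L ^ A + L ^ B ≤ L ^ (A + B + 1) := by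
    calc L ^ A + L ^ B ≤ 2 * L ^ (A + B) := by omega
      _ ≤ L * L ^ (A + B) := Nat.mul_le_mul_right _ hL2
      _ = L ^ (A + B + 1) := by ring
  have h4 : L ^ (A + B + 1) < 2 ^ L := pow_lt_two_pow (by simpa [add_assoc] using hLbig)
  omega

/-- `QFracU3 → QML3` (down the ladder: a `2^{−(log n)^B}` loss fraction of `2^(n−1)` exceeds `2^((log n)^A)`). -/
theorem qml3_of_qFracU3 (h : QFracU3) : QML3 := by
  obtain ⟨B, hB⟩ := h
  intro A c
  obtain ⟨n₀, hn₀⟩ := hB c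
  refine ⟨max n₀ (2 ^ (2 ^ (A + B + 2))), fun n hn P hP => ?_⟩
  have h1 := hn₀ n (le_trans (le_max_left _ _) hn) P hP
  have hnbig : 2 ^ (2 ^ (A + B + 2)) ≤ n := le_trans (le_max_right _ _) hn
  have hn1 : 1 ≤ n := le_trans (Nat.one_le_two_pow) hnbig
  set L := Nat.log 2 n with hL
  have hsum : L ^ A + L ^ B ≤ n - 1 := logpow_add_logpow_le hnbig
  have hw := winners_card_eq hn1 P
  have hl := losers_card_le hn1 P
  have hwR : ((winners n P).card : ℝ) = (2 : ℝ) ^ (n - 1) - (losers n P).card := by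
    rw [hw, Nat.cast_sub hl]; push_cast; ring
  rw [hwR] at h1
  have h2pos : (0 : ℝ) < (2 : ℝ) ^ (L ^ B) := pow_pos (by norm_num) _
  have h2 : (2 : ℝ) ^ (n - 1) / (2 : ℝ) ^ (L ^ B) ≤ (losers n P).card := by
    have : (2 : ℝ) ^ (n - 1) / (2 : ℝ) ^ (L ^ B) = (1 / (2 : ℝ) ^ (L ^ B)) * (2 : ℝ) ^ (n - 1) := by ring
    rw [this]; nlinarith
  have h3 : (2 : ℝ) ^ (L ^ A) ≤ (2 : ℝ) ^ (n - 1) / (2 : ℝ) ^ (L ^ B) := by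
    rw [le_div_iff₀ h2pos, ← pow_add]
    exact pow_le_pow_right₀ (by norm_num) hsum
  exact_mod_cast h3.trans h2

/-- `QML3 → NoPerfectOdd3` (down the ladder: `2^((log n)^0) = 2 ≥ 1` losses). -/
theorem noPerfectOdd3_of_qml3 (h : QML3) : NoPerfectOdd3 := by
  intro c
  obtain ⟨n₀, hn₀⟩ := h 0 c
  refine ⟨n₀, fun n hn P hP => ?_⟩
  have h1 := hn₀ n hn P hP
  have hpos : 0 < (losers n P).card := lt_of_lt_of_le (by positivity) h1
  obtain ⟨x, hx⟩ := Finset.card_pos.1 hpos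
  rw [losers, mem_filter] at hx
  exact ⟨x, hx.2.1, hx.2.2⟩

/-- `QFracU3 → NoPerfectOdd3`. -/
theorem noPerfectOdd3_of_qFracU3 (h : QFracU3) : NoPerfectOdd3 := noPerfectOdd3_of_qml3 (qml3_of_qFracU3 h)

/-! ### The exact cut of the residual 26533 at the covariance scale (kernel bookkeeping; any cut of a lift is exact) -/

/-- `MassStep3u ⟺ MesoLiftExact3 ∧ TopLift3` — the cut at `QFracU3`, read from exactness. [bookkeeping] -/
theorem massStep3u_iff_cut : MassStep3u ↔ (MesoLiftExact3 ∧ TopLift3) := by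
  constructor
  · intro hM
    exact ⟨fun hN => qFracU3_of_polyLossOddU3 (hM hN), fun hQ => hM (noPerfectOdd3_of_qFracU3 hQ)⟩
  · rintro ⟨hA, hB⟩ hN
    exact hB (hA hN)

/-- both pieces are consequences of the junction 26531 (hence of `T = RingHardOdd 3`, below). -/
theorem pieces_of_polyLossOddU3 (h : PolyLossOddU3) : MesoLift3 ∧ MesoLiftExact3 ∧ TopLift3 :=
  ⟨fun _ => qFracU3_of_polyLossOddU3 h, fun _ => qFracU3_of_polyLossOddU3 h, fun _ => h⟩

/-- `RingHardOdd 3 → PolyLossOddU3` (constant loss fraction ⟹ `1/n` loss fraction, `C = 1`). -/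
theorem polyLossOddU3_of_ringHardOdd3 (h : RingHardOdd 3) : PolyLossOddU3 := by
  obtain ⟨θ, hθ, hh⟩ := h
  refine ⟨1, fun c => ?_⟩
  obtain ⟨n₀, hn₀⟩ := hh c
  obtain ⟨N, hN⟩ := exists_nat_gt (1 / (1 - θ))
  refine ⟨max n₀ (max N 1), fun n hn P hP => ?_⟩
  have h1 := hn₀ n (le_trans (le_max_left _ _) hn) P hP
  have hnN : (N : ℝ) ≤ n := by exact_mod_cast le_trans (le_max_left _ _) (le_trans (le_max_right _ _) hn)
  have hn1 : (1 : ℝ) ≤ n := by exact_mod_cast le_trans (le_max_right _ _) (le_trans (le_max_right _ _) hn)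
  have hθ' : θ ≤ 1 - 1 / (n : ℝ) ^ 1 := by
    rw [pow_one]
    have h1θ : 0 < 1 - θ := by linarith
    have hNpos : (0 : ℝ) < n := by linarith
    have : 1 / (1 - θ) < n := lt_of_lt_of_le hN hnN
    rw [div_lt_iff₀ h1θ] at this
    have : 1 / (n : ℝ) ≤ 1 - θ := by
      rw [div_le_iff₀ hNpos]; nlinarith
    linarith
  exact h1.trans (mul_le_mul_of_nonneg_right hθ' (by positivity))

/-- ScaleDialA helper `pieces_of_ringHardOdd3` (decomp-qadv land package; see the module docstring). -/
theorem pieces_of_ringHardOdd3 (h : RingHardOdd 3) : MesoLift3 ∧ MesoLiftExact3 ∧ TopLift3 :=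
  pieces_of_polyLossOddU3 (polyLossOddU3_of_ringHardOdd3 h)

/-! ### Deciding theorems (by name) -/

/-- 26533 from the two pieces (exactness reading). -/
theorem closes_26533_exact (hA : MesoLiftExact3) (hB : TopLift3) : MassStep3u := massStep3u_iff_cut.2 ⟨hA, hB⟩

/-- the junction 26531 from exactness (26532) and the two pieces. -/
theorem closes_26531_exact (hN : NoPerfectOdd3) (hA : MesoLiftExact3) (hB : TopLift3) : PolyLossOddU3 := hB (hA hN)

/-- **`closes` (exactness reading)**: the rung leaf `AdviceFreeQNC0Three` BY NAME through ExactnessDial's own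
`closes` (tree `exactnessDial_closes₄`, bridge discharged). -/
theorem closes_exact (hN : NoPerfectOdd3) (hA : MesoLiftExact3) (hB : TopLift3) (hO : OddToAll3) (hD : DPLift3) :
    Summit.QuantumAdvantage.AdviceFreeQNC0.AdviceFreeQNC0Three :=
  Summit.QuantumAdvantage.QuantumAdvantage.Theorems.exactnessDial_closes₄ hN (closes_26533_exact hA hB) hO hD


/-! ## The TOP flank: quasi-polynomial symmetrisation (`QFracU3 ⟺ CovQFracU3`, hence `TopLift3 ⟺ CovTopLift3`)

The tree's `𝔽₃` leader election (`RingLeaderElection3.exists_election3`) and symmetrisation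
(`RingSymmetrization3.symmetrization3`) are run at the QUASI-POLYNOMIAL failure divisor `M = 2^((log₂ n)^B)`:
trials `t = L^B + 2L + 3`, window `ℓ = L^B + 3L + 4` — the election degree `4tℓ ≤ L^(2·max B 2 + 2)` is STILL
POLYLOG, so one covariant polynomial is the WLOG adversary from loss fraction `2^(−polylog n)` upward.  Below that
scale (`M = 2^(n^ε)`) the election degree leaves polylog: `QFracU3` is the theorem-pinned FLOOR of covariance. -/

section TopFlank

open Summit.QuantumAdvantage.QuantumAdvantage.Theorems
open Summit.QuantumAdvantage.QuantumAdvantage.Theorems.RingSymmetrization3 (symmetrization3 filter_cov_eq)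

/-- restriction (easy direction, same exponent): `QFracU3 → CovQFracU3`. -/
theorem cov_of_qFracU3 (h : QFracU3) : CovQFracU3 := by
  obtain ⟨B, hB⟩ := h
  refine ⟨B, fun c => ?_⟩
  obtain ⟨n₀, hn₀⟩ := hB c
  refine ⟨n₀, fun n hn Q hQ => ?_⟩
  rw [filter_cov_eq]
  exact hn₀ n hn (covStrat Q) (covStrat_mem_lowDeg hQ)

/-- quasi-polynomial election bookkeeping: for `n ≥ 2^(2^(max B 2 + 2))`, `L = log₂ n`, `t = L^B + 2L + 3`,
`ℓ = L^B + 3L + 4`, `M = 2^(L^B)`: `2ℓ ≤ n`, `2n²M ≤ 2^t`, `2n³M ≤ 2^ℓ`, `4tℓ ≤ L^(2·max B 2 + 2)`. -/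
theorem qelection_params (B n : ℕ) (hn : 2 ^ (2 ^ (max B 2 + 2)) ≤ n) :
    let L := Nat.log 2 n
    let t := L ^ B + 2 * L + 3
    let ℓ := L ^ B + 3 * L + 4
    2 * ℓ ≤ n ∧ 2 * n ^ 2 * 2 ^ (L ^ B) ≤ 2 ^ t ∧ 2 * n ^ 3 * 2 ^ (L ^ B) ≤ 2 ^ ℓ ∧
      t * (2 * (2 * ℓ)) ≤ L ^ (2 * max B 2 + 2) := by
  intro L t ℓ
  set m := max B 2 with hm
  have hn0 : n ≠ 0 := by have := Nat.one_le_two_pow (n := 2 ^ (m + 2)); omega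
  have hL : 2 ^ (m + 2) ≤ L := Nat.le_log_of_pow_le (by norm_num) hn
  have h16 : 16 ≤ L := le_trans (by
    calc 16 = 2 ^ 4 := rfl
      _ ≤ 2 ^ (m + 2) := Nat.pow_le_pow_right (by norm_num) (by omega)) hL
  have hnL : n < 2 ^ (L + 1) := Nat.lt_pow_succ_log_self (by norm_num) n
  have hLn : 2 ^ L ≤ n := Nat.pow_log_le_self 2 hn0
  have hLB : L ^ B ≤ L ^ m := Nat.pow_le_pow_right (by omega) (le_max_left _ _)
  have hL2 : L ^ 2 ≤ L ^ m := Nat.pow_le_pow_right (by omega) (le_max_right _ _)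
  have ht2 : t ≤ 2 * L ^ m := by
    show L ^ B + 2 * L + 3 ≤ 2 * L ^ m
    nlinarith
  have hl2 : ℓ ≤ 2 * L ^ m := by
    show L ^ B + 3 * L + 4 ≤ 2 * L ^ m
    nlinarith
  refine ⟨?_, ?_, ?_, ?_⟩
  · have h1 : L ^ (m + 1) < 2 ^ L := pow_lt_two_pow hL
    have h2 : 2 * ℓ ≤ L ^ (m + 1) := by
      calc 2 * ℓ ≤ 4 * L ^ m := by omega
        _ ≤ L * L ^ m := Nat.mul_le_mul_right _ (by omega)
        _ = L ^ (m + 1) := by ring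
    omega
  · have h1 : n ^ 2 < (2 ^ (L + 1)) ^ 2 := Nat.pow_lt_pow_left hnL (by norm_num)
    rw [← pow_mul] at h1
    have et : 2 ^ t = 2 * 2 ^ ((L + 1) * 2) * 2 ^ (L ^ B) := by
      show 2 ^ (L ^ B + 2 * L + 3) = _
      rw [show L ^ B + 2 * L + 3 = 1 + (L + 1) * 2 + L ^ B by ring, pow_add, pow_add, pow_one]
    rw [et]
    exact Nat.mul_le_mul_right _ (Nat.mul_le_mul_left _ h1.le)
  · have h1 : n ^ 3 < (2 ^ (L + 1)) ^ 3 := Nat.pow_lt_pow_left hnL (by norm_num)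
    rw [← pow_mul] at h1
    have el : 2 ^ ℓ = 2 * 2 ^ ((L + 1) * 3) * 2 ^ (L ^ B) := by
      show 2 ^ (L ^ B + 3 * L + 4) = _
      rw [show L ^ B + 3 * L + 4 = 1 + (L + 1) * 3 + L ^ B by ring, pow_add, pow_add, pow_one]
    rw [el]
    exact Nat.mul_le_mul_right _ (Nat.mul_le_mul_left _ h1.le)
  · calc t * (2 * (2 * ℓ)) = 4 * (t * ℓ) := by ring
      _ ≤ 4 * ((2 * L ^ m) * (2 * L ^ m)) := Nat.mul_le_mul_left _ (Nat.mul_le_mul ht2 hl2)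
      _ = 16 * L ^ (2 * m) := by ring
      _ ≤ L * L ^ (2 * m) := Nat.mul_le_mul_right _ h16
      _ ≤ L * L ^ (2 * m) * L := Nat.le_mul_of_pos_right _ (by omega)
      _ = L ^ (2 * m + 2) := by ring

/-- **THE TOP LAW — quasi-polynomial symmetrisation** (hard direction, `B ↦ B + 1`): a covariant one-polynomial
win bound `(1 − 2^{−L^B})·2^(n−1)` at every polylog degree ⟹ the same bound with exponent `B+1` for all
polylog-degree STRATEGIES.  Leader election at failure divisor `M = 2^(L^B)` (`qelection_params`), then
`symmetrization3`; the bad set `2ⁿ/(n·2^(L^B))` is absorbed into the loss. -/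
theorem qFracU3_of_cov (h : CovQFracU3) : QFracU3 := by
  obtain ⟨B, hB⟩ := h
  refine ⟨B + 1, fun c => ?_⟩
  set m := max B 2 with hm
  obtain ⟨n₁, hn₁⟩ := hB (max c (2 * m + 2) + 1)
  refine ⟨max n₁ (2 ^ (2 ^ (m + 2))), fun n hn P hP => ?_⟩
  have hn₁' : n₁ ≤ n := le_trans (le_max_left _ _) hn
  have hnB : 2 ^ (2 ^ (m + 2)) ≤ n := le_trans (le_max_right _ _) hn
  obtain ⟨h2l, ht, hl, hdeg⟩ := qelection_params B n hnB
  set L := Nat.log 2 n with hL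
  have hLm : 2 ^ (m + 2) ≤ L := Nat.le_log_of_pow_le (by norm_num) hnB
  have h16 : 16 ≤ L := le_trans (by
    calc 16 = 2 ^ 4 := rfl
      _ ≤ 2 ^ (m + 2) := Nat.pow_le_pow_right (by norm_num) (by omega)) hLm
  have hn0' : n ≠ 0 := by have := Nat.one_le_two_pow (n := 2 ^ (m + 2)); omega
  have hLn : 2 ^ L ≤ n := Nat.pow_log_le_self 2 hn0'
  have hn4 : 4 ≤ n := le_trans (le_trans (by norm_num) (Nat.pow_le_pow_right (by norm_num) h16 : 2 ^ 16 ≤ 2 ^ L)) hLn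
  have hn0 : 0 < n := by omega
  obtain ⟨e, he, he01, hbad⟩ := RingLeaderElection3.exists_election3 hn0 h2l ht hl
  -- degree bookkeeping: `L^c + 4tℓ ≤ L^c + L^(2m+2) ≤ L^(max c (2m+2) + 1)`
  have hdeg' : L ^ c + (L ^ B + 2 * L + 3) * (2 * (2 * (L ^ B + 3 * L + 4))) ≤ L ^ (max c (2 * m + 2) + 1) := by
    have h1 : L ^ c ≤ L ^ max c (2 * m + 2) := Nat.pow_le_pow_right (by omega) (le_max_left _ _)
    have h2 : L ^ (2 * m + 2) ≤ L ^ max c (2 * m + 2) := Nat.pow_le_pow_right (by omega) (le_max_right _ _)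
    calc L ^ c + (L ^ B + 2 * L + 3) * (2 * (2 * (L ^ B + 3 * L + 4)))
        ≤ L ^ max c (2 * m + 2) + L ^ max c (2 * m + 2) := Nat.add_le_add h1 (hdeg.trans h2)
      _ = 2 * L ^ max c (2 * m + 2) := by ring
      _ ≤ L * L ^ max c (2 * m + 2) := Nat.mul_le_mul_right _ (by omega)
      _ = L ^ (max c (2 * m + 2) + 1) := by ring
  set q : ℝ := (2 : ℝ) ^ (L ^ B) with hq
  set A : ℝ := (2 : ℝ) ^ (n - 1) with hA'
  set W : ℝ := (1 - 1 / q) * A with hW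
  have hE : ∀ Q : CubeFn (ZMod 3) n, Q ∈ lowDeg (ZMod 3) n
      (L ^ c + (L ^ B + 2 * L + 3) * (2 * (2 * (L ^ B + 3 * L + 4)))) →
      ((univ.filter fun x : Fin n → Bool => OddZeros x ∧ RingHLF.Rel x (cov Q x)).card : ℝ) ≤ W :=
    fun Q hQ => hn₁ n hn₁' Q (lowDeg_mono hdeg' hQ)
  have hmain := symmetrization3 hn0 he he01 W hE P hP
  set Bad := (univ.filter fun x : Fin n → Bool => RingLeaderElection3.fireCount3 e x ≠ 1).card with hBad
  have hbadR : (Bad : ℝ) * ((n : ℝ) * q) ≤ (2 : ℝ) ^ n := by rw [hq]; exact_mod_cast hbad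
  have hA : (2 : ℝ) ^ n = 2 * A := by
    rw [hA', ← pow_succ']; congr 1; omega
  rw [hA] at hbadR
  have hApos : 0 < A := by positivity
  have hq1 : 1 ≤ q := one_le_pow₀ (by norm_num)
  have hqpos : 0 < q := by linarith
  have hnR : (4 : ℝ) ≤ n := by exact_mod_cast hn4
  have hnpos : (0 : ℝ) < n := by linarith
  -- `Bad ≤ 2A/(n q) ≤ A/(2q)`
  have hBad_le : (Bad : ℝ) ≤ A / (2 * q) := by
    rw [le_div_iff₀ (by positivity)]
    nlinarith
  -- `2 q ≤ q' := 2^(L^(B+1))`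
  set q' : ℝ := (2 : ℝ) ^ (L ^ (B + 1)) with hq'
  have hqq : 2 * q ≤ q' := by
    rw [hq, hq', ← pow_succ']
    refine pow_le_pow_right₀ (by norm_num) ?_
    have : 1 ≤ L ^ B := Nat.one_le_pow _ _ (by omega)
    calc L ^ B + 1 ≤ 2 * L ^ B := by omega
      _ ≤ L * L ^ B := Nat.mul_le_mul_right _ (by omega)
      _ = L ^ (B + 1) := by ring
  have hq'pos : 0 < q' := by positivity
  have hfin : (1 - 1 / q) * A + A / (2 * q) ≤ (1 - 1 / q') * A := by
    have e1 : (1 - 1 / q) * A + A / (2 * q) = A - A / (2 * q) := by field_simp; ring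
    rw [e1]
    have : A / q' ≤ A / (2 * q) := div_le_div_of_nonneg_left hApos.le (by positivity) hqq
    have e2 : (1 - 1 / q') * A = A - A / q' := by field_simp
    rw [e2]; linarith
  calc ((winners n P).card : ℝ)
      = ((univ.filter fun x : Fin n → Bool =>
          OddZeros x ∧ RingHLF.Rel x (fun i => decide (P i x = 1))).card : ℝ) := rfl
    _ ≤ W + Bad := hmain
    _ ≤ (1 - 1 / q) * A + A / (2 * q) := by rw [hW]; linarith
    _ ≤ (1 - 1 / q') * A := hfin

/-- **`QFracU3 ⟺ CovQFracU3`**: at the quasi-polynomial loss-fraction scale the adversary is WLOG one covariant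
polynomial (the covariance FLOOR of the loss ladder). -/
theorem qFracU3_iff_cov : QFracU3 ↔ CovQFracU3 := ⟨cov_of_qFracU3, qFracU3_of_cov⟩

/-- the tree's symmetrisation law, restated with this file's name for the covariant junction. -/
theorem polyLossOddU3_iff_cov' : PolyLossOddU3 ↔ CovPolyLossOddU3 := RingSymmetrization3.polyLossOddU3_iff_cov

/-- **`TopLift3 ⟺ CovTopLift3`**: the density upgrade is a statement about ONE rotation-covariant polylog-degree
polynomial `Q` — from `#{odd x : Rel x (cov Q x)} ≤ (1 − 2^{−polylog})·2^(n−1)` to `≤ (1 − n^{−C})·2^(n−1)`. -/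
theorem topLift3_iff_cov : TopLift3 ↔ CovTopLift3 := by
  unfold TopLift3 CovTopLift3
  rw [qFracU3_iff_cov, polyLossOddU3_iff_cov']

end TopFlank

end Summit.QuantumAdvantage.QuantumAdvantage.Theorems.ScaleDial
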